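import Literature.NumberTheory.ComplexMultiplication.CMTypeRankQuadraticSexticSlot
import HarnessLib

/-!
# A sextic CM field through an imaginary quadratic field `k` against ANY field avoiding `k` whose Galois closure does not
# contain it: no common constituent (criterion (λ) for CM fields, unrestricted form)

Sequel of `NumberTheory/ComplexMultiplication/CMTypeRankQuadraticSexticSlot` (criterion (λ) for a sextic CM field
`K_i ⊇ e(k)`, `k` imaginary quadratic, against a field `K_j` with `k ↪̸ K_j`, under the hypothesis `L_i ⊄ L_j · k̃`; fibre
transitivity of `Aut(ℂ/M)` when `k̃ ⊆ M`).  Here the hypothesis is relaxed to the natural one, **`L_i ⊄ L_j`** (the Galois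
closure of `K_i` is not inside that of `K_j`), by treating the remaining case `k̃ ⊄ L_j`:

* `conj_apply_eq_of_mem_inf_fieldRange_of_not_mem` — if `s(e(k)) ⊄ M` (`M ≤ ℂ` normal of finite degree), complex
  conjugation FIXES `M ∩ s(K_i)` POINTWISE: that conjugation-stable subfield of the sextic CM field `s(K_i)` is not
  `s(K_i)`, is not quadratic (the only quadratic subfield is `s(e(k)) ⊄ M` — two quadratic subfields would span a quartic
  one), so has odd degree `1` or `3`, and a conjugation-stable field moved by conjugation has even degree (Artin);
* `exists_ringEquiv_apply_eq_and_smul_eq_conj_of_not_mem` — hence some automorphism of `ℂ` fixing `M` pointwise maps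
  `s` to `s̄` (glue conjugation on `M` with the identity on `s(K_i)`, then conjugate);
* **`pairwise_of_quadratic_sextic_of_not_le`** — criterion (λ), unrestricted: `[K_i : ℚ] = 6`, `e : k → K_i`,
  `[k : ℚ] = 2`, `k` totally complex, `L_i ⊄ L_j`, `k ↪̸ K_j` ⟹ `U(Φ_i)`, `U(Φ_j)` have no common constituent, in both
  orders, for all CM types `Φ_i`, `Φ_j`.  (If `k̃ ⊆ L_j` this is the prequel with `L_j · k̃ = L_j`; if `k̃ ⊄ L_j` every odd
  weight on `Hom(K_i, ℂ)` fixed by `Aut(ℂ/L_j)` vanishes, since `s̄ ∈ Aut(ℂ/L_j) · s` for every `s`.)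

On Hodge groups: a simple CM abelian threefold `T` whose sextic CM field contains the imaginary quadratic field `k` and ANY
CM abelian variety `B` with `k ↪̸ End⁰(B)`-field and `L_T ⊄ L_B` have `Hg`-character modules without common simple
factor — the input of the block criterion (`…/CMTypeRankPartitionSlots`).  Theorems only; no definition, no named fact,
no `sorry`.  Cell `pub-hodgecm2` (COR-CM), count-neutral own lane (seat b16).

## References
* [MoonenZarhin1999LowDim] B. Moonen, Yu. Zarhin, Math. Ann. 315 (1999) 711–733, Thm. (0.2) (a), (3.1), (3.9).
* [Lang2002] S. Lang, *Algebra*, GTM 211, VI §1 Thm. 1.1, Cor. 1.6, Thm. 1.8 (Artin), Thm. 1.14; V §2 Thm. 2.8.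
* [Shimura1998] G. Shimura, *Abelian Varieties with Complex Multiplication and Modular Functions*, §8.4 (2), §18.1.
* [Gordon1999HodgeAVSurvey] B. B. Gordon, *A survey of the Hodge conjecture for abelian varieties*, §3 Theorem (proof).
-/

noncomputable section

open scoped BigOperators
open IntermediateField NumberField Module

namespace Literature.NumberTheory.ComplexMultiplication

/-! ### §1 Complex conjugation on `M ∩ s(K_i)` when `s(e(k)) ⊄ M` -/

section Conj

variable {I : Type} {K : I → Type} [∀ i, Field (K i)] [∀ i, NumberField (K i)] [∀ i, IsCMField (K i)]
variable {k : Type} [Field k] [NumberField k]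

/-- The image of an embedding of a number field is finite over `ℚ`. [folklore] -/
private theorem finiteDimensional_fieldRange₄₅ {F : Type} [Field F] [NumberField F] (f : F →ₐ[ℚ] ℂ) :
    FiniteDimensional ℚ f.fieldRange :=
  LinearEquiv.finiteDimensional (AlgEquiv.ofInjectiveField f).toLinearEquiv

/-- A subfield of a finite extension (inside `ℂ`) is finite. [folklore] -/
private theorem finiteDimensional_of_le₄₅ {E E' : IntermediateField ℚ ℂ} [FiniteDimensional ℚ E] (h : E' ≤ E) :
    FiniteDimensional ℚ E' :=
  FiniteDimensional.of_injective (IntermediateField.inclusion h).toLinearMap (IntermediateField.inclusion_injective h)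

/-- The image of a CM field under a complex embedding is stable under complex conjugation (`s̄ = s ∘ c`).
[cite: Shimura1998, §18.1] -/
private theorem conj_mem_fieldRange₄₅ {i : I} (s : K i →+* ℂ) {z : ℂ} (hz : z ∈ s.toRatAlgHom.fieldRange) :
    starRingEnd ℂ z ∈ s.toRatAlgHom.fieldRange := by
  obtain ⟨a, rfl⟩ := AlgHom.mem_fieldRange.1 hz
  exact AlgHom.mem_fieldRange.2 ⟨IsCMField.complexConj (K i) a, by
    change s (IsCMField.complexConj (K i) a) = starRingEnd ℂ (s a)
    exact IsCMField.complexEmbedding_complexConj (K i) s a⟩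

/-- A subfield of `ℂ` of finite degree, stable under complex conjugation and NOT fixed pointwise by it, has EVEN degree
(Artin: the fixed field of `{1, c}` has index `2`). [cite: Lang2002, VI §1 Thm. 1.8] -/
private theorem even_finrank_of_conj_mem₄₅ (Q : IntermediateField ℚ ℂ) [FiniteDimensional ℚ Q]
    (hQ : ∀ z : ℂ, z ∈ Q → starRingEnd ℂ z ∈ Q) {z : ℂ} (hz : z ∈ Q) (hcz : starRingEnd ℂ z ≠ z) :
    2 ∣ finrank ℚ ↥Q := by
  classical
  let c : ↥Q ≃ₐ[ℚ] ↥Q :=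
    { toFun := fun x => ⟨starRingEnd ℂ x, hQ x x.2⟩
      invFun := fun x => ⟨starRingEnd ℂ x, hQ x x.2⟩
      left_inv := fun x => Subtype.ext (Complex.conj_conj _)
      right_inv := fun x => Subtype.ext (Complex.conj_conj _)
      map_mul' := fun x y => Subtype.ext (map_mul _ _ _)
      map_add' := fun x y => Subtype.ext (map_add _ _ _)
      commutes' := fun q => Subtype.ext (by
        change starRingEnd ℂ (algebraMap ℚ ℂ q) = algebraMap ℚ ℂ q
        rw [eq_ratCast, map_ratCast]) }
  have hc : ∀ x : ↥Q, ((c x : ↥Q) : ℂ) = starRingEnd ℂ x := fun _ => rfl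
  have hc1 : c ≠ 1 := fun h => hcz (by
    have := congrArg (fun f : ↥Q ≃ₐ[ℚ] ↥Q => ((f ⟨z, hz⟩ : ↥Q) : ℂ)) h
    simpa [hc] using this)
  have hc2 : c ^ 2 = 1 := by
    rw [pow_two]
    exact AlgEquiv.ext fun x => Subtype.ext (by rw [AlgEquiv.mul_apply, AlgEquiv.one_apply, hc, hc, Complex.conj_conj])
  have hord : orderOf c = 2 := orderOf_eq_prime hc2 hc1
  have hcard : Nat.card (Subgroup.zpowers c) = 2 := by rw [Nat.card_zpowers, hord]
  have hfix : finrank ↥(IntermediateField.fixedField (Subgroup.zpowers c)) ↥Q = 2 := by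
    rw [IntermediateField.finrank_fixedField_eq_card, hcard]
  have htower := Module.finrank_mul_finrank ℚ ↥(IntermediateField.fixedField (Subgroup.zpowers c)) ↥Q
  rw [hfix] at htower
  exact Dvd.intro_left _ htower

/-- **If `s(e(k)) ⊄ M` then complex conjugation fixes `M ∩ s(K_i)` pointwise** (`K_i ⊇ e(k)` sextic CM, `k` quadratic,
`M ≤ ℂ` normal of finite degree): `D = M ∩ s(K_i)` is conjugation-stable, `≠ s(K_i)`, and not quadratic (else `D` and
`s(e(k))` would be two different quadratic subfields of a sextic field, spanning a quartic one); so `[D : ℚ] ∈ {1, 3}` is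
odd and Artin forbids conjugation to move `D`. [cite: Lang2002, VI §1 Thm. 1.8 and Cor. 1.6] [cite: Shimura1998, §18.1] -/
theorem conj_apply_eq_of_mem_inf_fieldRange_of_not_mem {i : I} (hk : finrank ℚ k = 2) (h6 : finrank ℚ (K i) = 6)
    (e : k →+* K i) (M : IntermediateField ℚ ℂ) [FiniteDimensional ℚ M]
    [@Normal ℚ M _ _ (IntermediateField.algebra' M)] {s : K i →+* ℂ} (hkM : ¬ ∀ z : k, s (e z) ∈ M) {x : ℂ}
    (hxM : x ∈ M) (hxS : x ∈ s.toRatAlgHom.fieldRange) : starRingEnd ℂ x = x := by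
  classical
  by_contra hcx
  set S : IntermediateField ℚ ℂ := s.toRatAlgHom.fieldRange with hS_def
  set Q : IntermediateField ℚ ℂ := (s.comp e).toRatAlgHom.fieldRange with hQ_def
  haveI : FiniteDimensional ℚ ↥S := finiteDimensional_fieldRange₄₅ _
  haveI : FiniteDimensional ℚ ↥Q := finiteDimensional_fieldRange₄₅ _
  haveI : FiniteDimensional ℚ ↥(M ⊓ S) := finiteDimensional_of_le₄₅ (inf_le_right : M ⊓ S ≤ S)
  haveI : FiniteDimensional ℚ ↥(M ⊓ S ⊔ Q) :=
    finiteDimensional_of_le₄₅ (sup_le (inf_le_right : M ⊓ S ≤ S) (by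
      intro y hy
      obtain ⟨z, rfl⟩ := AlgHom.mem_fieldRange.1 hy
      exact AlgHom.mem_fieldRange.2 ⟨e z, rfl⟩) : M ⊓ S ⊔ Q ≤ S)
  have h6S : finrank ℚ ↥S = 6 := ((AlgEquiv.ofInjectiveField s.toRatAlgHom).toLinearEquiv.finrank_eq).symm.trans h6
  have h2Q : finrank ℚ ↥Q = 2 :=
    ((AlgEquiv.ofInjectiveField (s.comp e).toRatAlgHom).toLinearEquiv.finrank_eq).symm.trans hk
  have hQS : Q ≤ S := by
    intro y hy
    obtain ⟨z, rfl⟩ := AlgHom.mem_fieldRange.1 hy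
    exact AlgHom.mem_fieldRange.2 ⟨e z, rfl⟩
  have hDS : M ⊓ S ≤ S := inf_le_right
  -- `D = M ∩ S` is conjugation-stable and moved by conjugation: even degree
  have h2dvd : 2 ∣ finrank ℚ ↥(M ⊓ S) :=
    even_finrank_of_conj_mem₄₅ (M ⊓ S)
      (fun y hy => ⟨smul_mem_of_normal M (starRingAut : ℂ ≃+* ℂ) hy.1, conj_mem_fieldRange₄₅ s hy.2⟩) ⟨hxM, hxS⟩ hcx
  have hdvd6 : finrank ℚ ↥(M ⊓ S) ∣ 6 := h6S ▸ IntermediateField.finrank_dvd_of_le_right hDS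
  -- `D ≠ S` (since `s(e(k)) ⊄ M`)
  have hQnot : ¬ Q ≤ M ⊓ S := fun h => hkM fun z =>
    (h (AlgHom.mem_fieldRange.2 ⟨z, rfl⟩ : s (e z) ∈ Q) : s (e z) ∈ M ⊓ S).1
  have hne6 : finrank ℚ ↥(M ⊓ S) ≠ 6 := fun h =>
    hQnot (((IntermediateField.eq_of_le_of_finrank_eq hDS (h.trans h6S.symm)).symm ▸ hQS))
  -- `D` is not quadratic: `D ⊔ Q` would be a quartic subfield of the sextic `S`
  have hne2 : finrank ℚ ↥(M ⊓ S) ≠ 2 := by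
    intro hD2
    have hlt : M ⊓ S < M ⊓ S ⊔ Q := lt_of_le_of_ne le_sup_left fun h => hQnot (h ▸ le_sup_right)
    have hle4 : finrank ℚ ↥(M ⊓ S ⊔ Q) ≤ 4 := by
      have := IntermediateField.finrank_sup_le (M ⊓ S) Q
      rw [hD2, h2Q] at this
      exact this
    have h2dvd' : 2 ∣ finrank ℚ ↥(M ⊓ S ⊔ Q) :=
      hD2 ▸ IntermediateField.finrank_dvd_of_le_right (le_sup_left : M ⊓ S ≤ M ⊓ S ⊔ Q)
    have hne2' : finrank ℚ ↥(M ⊓ S ⊔ Q) ≠ 2 := fun h =>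
      hlt.ne (IntermediateField.eq_of_le_of_finrank_eq hlt.le (hD2.trans h.symm))
    have hdvd6' : finrank ℚ ↥(M ⊓ S ⊔ Q) ∣ 6 :=
      h6S ▸ IntermediateField.finrank_dvd_of_le_right (sup_le hDS hQS : M ⊓ S ⊔ Q ≤ S)
    have hpos' : 0 < finrank ℚ ↥(M ⊓ S ⊔ Q) := Module.finrank_pos
    have hle6' : finrank ℚ ↥(M ⊓ S ⊔ Q) ≤ 6 := Nat.le_of_dvd (by norm_num) hdvd6'
    obtain ⟨m, hm⟩ := h2dvd'
    interval_cases h : finrank ℚ ↥(M ⊓ S ⊔ Q) <;> omega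
  have hpos : 0 < finrank ℚ ↥(M ⊓ S) := Module.finrank_pos
  have hle6 : finrank ℚ ↥(M ⊓ S) ≤ 6 := Nat.le_of_dvd (by norm_num) hdvd6
  obtain ⟨m, hm⟩ := h2dvd
  interval_cases h : finrank ℚ ↥(M ⊓ S) <;> omega

/-- **If `s(e(k)) ⊄ M` then some automorphism of `ℂ` fixing `M` pointwise maps `s` to `s̄`**: glue complex conjugation
on the normal field `M` with the identity on `s(K_i)` (they agree on `M ∩ s(K_i)` by the previous theorem), then follow
with complex conjugation. [cite: Lang2002, VI §1 Thm. 1.14 and V §2 Thm. 2.8] -/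
theorem exists_ringEquiv_apply_eq_and_smul_eq_conj_of_not_mem {i : I} (hk : finrank ℚ k = 2)
    (h6 : finrank ℚ (K i) = 6) (e : k →+* K i) (M : IntermediateField ℚ ℂ) [FiniteDimensional ℚ M]
    [@Normal ℚ M _ _ (IntermediateField.algebra' M)] {s : K i →+* ℂ} (hkM : ¬ ∀ z : k, s (e z) ∈ M) :
    ∃ τ : ℂ ≃+* ℂ, (∀ y : ℂ, y ∈ M → τ y = y) ∧ τ • s = (starRingAut : ℂ ≃+* ℂ) • s := by
  haveI : FiniteDimensional ℚ ↥s.toRatAlgHom.fieldRange := finiteDimensional_fieldRange₄₅ _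
  obtain ⟨τ₀, hτ₀M, hτ₀S⟩ := exists_ringEquiv_apply_eq_of_normal_left (A := M) (M := s.toRatAlgHom.fieldRange)
    (starRingAut : ℂ ≃+* ℂ) (fun x hxM hxS => by
      rw [starRingAut_apply, ← starRingEnd_apply]
      exact conj_apply_eq_of_mem_inf_fieldRange_of_not_mem hk h6 e M hkM hxM hxS)
  refine ⟨starRingAut * τ₀, fun y hy => ?_, RingHom.ext fun z => ?_⟩
  · rw [RingAut.mul_apply, hτ₀M y hy, starRingAut_apply, starRingAut_apply, star_star]
  · have h2 : τ₀ (s z) = s z := hτ₀S (s z) (AlgHom.mem_fieldRange.2 ⟨z, rfl⟩)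
    rw [ringEquiv_smul_apply, ringEquiv_smul_apply, RingAut.mul_apply, h2]

end Conj

/-! ### §2 Criterion (λ) for CM fields, unrestricted: `L_i ⊄ L_j` and `k ↪̸ K_j` -/

section Lambda

open Literature.AlgebraicGeometry.Pohlmann1968
open Literature.AlgebraicGeometry.Motives (CMType)

variable {I : Type} {K : I → Type} [∀ i, Field (K i)] [∀ i, NumberField (K i)] [∀ i, IsCMField (K i)]
variable {k : Type} [Field k] [NumberField k] [IsTotallyComplex k]

open scoped Classical in
/-- **Criterion (λ) for CM fields, unrestricted form.**  Let `[K_i : ℚ] = 6`, `e : k → K_i` with `[k : ℚ] = 2`, `k`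
totally complex; suppose the Galois closure `L_i` of `K_i` in `ℂ` is NOT contained in the Galois closure `L_j` of `K_j`,
and `k` does NOT embed in `K_j`.  Then `U(Φ_i)` and `U(Φ_j)` have no common constituent, in both orders, for all CM types
`Φ_i`, `Φ_j` — `Hg(A_i × A_j) = Hg(A_i) × Hg(A_j)` for a simple CM threefold `A_i` of non-pair-flip type against every CM
`A_j` whose field avoids `k` and whose Galois closure misses `L_i`. [cite: MoonenZarhin1999LowDim, Thm. (0.2) (a) and (3.9)]
[cite: Gordon1999HodgeAVSurvey, §3 Theorem (proof)] -/
theorem pairwise_of_quadratic_sextic_of_not_le {Φ : ∀ i, CMType (K i)} {i j : I} (hk : finrank ℚ k = 2)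
    (h6 : finrank ℚ (K i) = 6) (e : k →+* K i) (hL : ¬ normalClosure ℚ (K i) ℂ ≤ normalClosure ℚ (K j) ℂ)
    (hkj : IsEmpty (k →+* K j)) :
    (∀ P : Submodule ℚ ((K i →+* ℂ) → ℚ), P ≤ antiSpan (ℂ ≃+* ℂ) (Φ i).1 →
      (∀ g : ℂ ≃+* ℂ, ∀ f ∈ P, (fun x => f (g • x)) ∈ P) →
      ∀ T : ((K i →+* ℂ) → ℚ) →ₗ[ℚ] ((K j →+* ℂ) → ℚ),
        (∀ g : ℂ ≃+* ℂ, ∀ f ∈ P, T (fun x => f (g • x)) = fun y => T f (g • y)) →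
        (∀ f ∈ P, T f ∈ antiSpan (ℂ ≃+* ℂ) (Φ j).1) → (∀ f ∈ P, T f = 0 → f = 0) → P = ⊥) ∧
    (∀ P : Submodule ℚ ((K j →+* ℂ) → ℚ), P ≤ antiSpan (ℂ ≃+* ℂ) (Φ j).1 →
      (∀ g : ℂ ≃+* ℂ, ∀ f ∈ P, (fun x => f (g • x)) ∈ P) →
      ∀ T : ((K j →+* ℂ) → ℚ) →ₗ[ℚ] ((K i →+* ℂ) → ℚ),
        (∀ g : ℂ ≃+* ℂ, ∀ f ∈ P, T (fun x => f (g • x)) = fun y => T f (g • y)) →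
        (∀ f ∈ P, T f ∈ antiSpan (ℂ ≃+* ℂ) (Φ i).1) → (∀ f ∈ P, T f = 0 → f = 0) → P = ⊥) := by
  haveI hNj : ∀ j : I, @Normal ℚ ↥(normalClosure ℚ (K j) ℂ) _ _ (IntermediateField.algebra' _) :=
    normal_normalClosure_complex
  by_cases hkL : normalClosure ℚ k ℂ ≤ normalClosure ℚ (K j) ℂ
  · -- `k̃ ⊆ L_j`: the prequel, with `L_j · k̃ = L_j`
    have hsup : normalClosure ℚ (K j) ℂ ⊔ normalClosure ℚ k ℂ = normalClosure ℚ (K j) ℂ := sup_eq_left.2 hkL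
    exact pairwise_of_quadratic_sextic (Φ := Φ) hk h6 e (by rw [hsup]; exact hL) hkj
  · -- `k̃ ⊄ L_j`: every `Aut(ℂ/L_j)`-fixed odd weight on `Hom(K_i, ℂ)` vanishes
    set M : IntermediateField ℚ ℂ := normalClosure ℚ (K j) ℂ with hM_def
    obtain ⟨ι₀⟩ : Nonempty (k →+* ℂ) := inferInstance
    set ρ : ℂ ≃+* ℂ := starRingAut with hρ_def
    have hρι : ρ • ι₀ ≠ ι₀ := fun h => by
      rw [conj_smul_eq_conjugate] at h
      exact IsTotallyComplex.complexEmbedding_not_isReal ι₀ (ComplexEmbedding.isReal_iff.2 h)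
    let χ : (ℂ ≃+* ℂ) → ℚ := fun g => if g • ι₀ = ι₀ then 1 else -1
    have hχρ : χ ρ = -1 := if_neg hρι
    -- no embedding of `K_i` maps `e(k)` into `M` (else every embedding of `k`, a conjugate of `x ∘ e`, lands in `M`)
    have hkM : ∀ x : K i →+* ℂ, ¬ ∀ z : k, x (e z) ∈ M := by
      intro x hx
      haveI := isPretransitive_ringEquiv_complex (K := k)
      refine hkL (normalClosure_le_iff.2 fun u y hy => ?_)
      obtain ⟨z, rfl⟩ := AlgHom.mem_fieldRange.1 hy
      obtain ⟨g, hg⟩ := MulAction.exists_smul_eq (ℂ ≃+* ℂ) (x.comp e) u.toRingHom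
      have h1 : u z = g (x (e z)) := by
        have := RingHom.congr_fun hg z
        rw [ringEquiv_smul_apply] at this
        exact this.symm
      change u z ∈ M
      rw [h1]
      exact smul_mem_of_normal M g (hx z)
    refine pairwise_of_fixed_subset_eigenline (G := ℂ ≃+* ℂ) (Φ := fun i => (Φ i).1)
      {τ : ℂ ≃+* ℂ | ∀ y : ℂ, y ∈ M → τ y = y} χ ?_ ?_ ?_
    · intro τ hτ t
      exact RingHom.ext fun x => by
        rw [ringEquiv_smul_apply]
        exact hτ _ (apply_mem_normalClosure j t x)
    · -- an `S`-fixed vector of `U(Φ_i)` is zero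
      intro f hf hfS g
      have hf0 : f = 0 := by
        funext x
        obtain ⟨τ, hτM, hτx⟩ := exists_ringEquiv_apply_eq_and_smul_eq_conj_of_not_mem hk h6 e M (hkM x)
        have h1 := congrFun (hfS τ hτM) x
        rw [hτx] at h1
        have h2 : f (ρ • x) = -f x := apply_rho_smul_of_mem_antiSpan (isCMTypeWith_conj (Φ i)) hf x
        rw [hρ_def] at h2
        rw [h2] at h1
        simp only [Pi.zero_apply]
        linarith
      rw [hf0, smul_zero]
      rfl
    · intro f hf heig
      refine eq_zero_of_eigen_of_transitive (G := ℂ ≃+* ℂ) χ heig (fun x y => ?_) (g₀ := ρ) (by rw [hχρ]; norm_num)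
      obtain ⟨τ, hτk, hτx⟩ := exists_ringEquiv_smul_eq_of_isEmpty hk hkj x y
      exact ⟨τ, if_pos (hτk ι₀), hτx⟩

end Lambda

end Literature.NumberTheory.ComplexMultiplication

end
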